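import Summits.CriticalPhenomena.SAWScalingLimit.Theses.SAWDefectDecoherence
import Summits.CriticalPhenomena.SAWScalingLimit.Theorems.SAWDefectDecoherenceBoundaryClosureREquivalence
import Summits.CriticalPhenomena.SAWScalingLimit.Theorems.SAWDefectDecoherencePolygonParitySqueezeDefs
import Summits.CriticalPhenomena.SAWScalingLimit.Theorems.SAWDefectDecoherenceBoundaryClosureRArrivalMonotone
import Summits.CriticalPhenomena.SAWScalingLimit.Theorems.SAWDefectDecoherenceBoundaryClosureRSqueeze
import Summits.CriticalPhenomena.SAWScalingLimit.Theorems.SAWDefectDecoherenceBoundaryClosureRGateTraceOfGateData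
import Summits.CriticalPhenomena.SAWScalingLimit.Theorems.SAWDefectDecoherenceBoundaryClosureRGateStability
import Summits.CriticalPhenomena.SAWScalingLimit.Theorems.SAWDefectDecoherenceBoundaryClosureRGateDbarLimit
import Summits.CriticalPhenomena.SAWScalingLimit.Theorems.SAWDefectDecoherenceBoundaryClosureRInnerZigzagSep
import Summits.CriticalPhenomena.SAWScalingLimit.Theorems.SAWDefectDecoherenceBoundaryClosureRZigzagDiscretisation
import HarnessLib.Audit

/-!
# Crux `BoundaryClosureR` (stmt-CriticalPhenomena-14004) — line `tempered-polygon-cauchy`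
# (strategist gen 1, 2026-08-17): the identification half [II] on exact polygons from a PURELY
# POSITIVE package — tempered (distributional) compactness by the exact global Green identity,
# Cauchy structure of the limit, root closed by positive window growth with exponent room 2

STATE OF THE CRUX (certificate p122667): `BoundaryClosureR ↔ (DD → MR → [I] LocalL1Root ∧ [II]
GateTraceH)`.  The live line `polygon-parity-squeeze` (lead c6, r5) produces [II] from the polygon
package `PolygonL1 ∧ PolygonLayerBudget ∧ PolygonRatioMixing`, `GateCollarAvoidance` and
`GateL1Root`; its (B) squeeze, (C) gate trace, inner polygons and gate stability are LANDED.  Of its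
three model inputs, TWO are of the engine-less [I]-type: `GateL1Root` (⊇ LocalL1Root, necessary-type)
AND `PolygonL1` (the `L¹` law of the COMPLEX observable up to every side and corner of the polygon +
root tightness — phase cancellation at the sharp rate `25/48`, used only for weak-* compactness of
the normalised functionals as MEASURES and for the root pole order).

THIS LINE removes `PolygonL1`.  The OUTPUT of the polygon identification (`PolygonGateProfile`) is
a law of POSITIVE gate masses, and none of its proof needs an `L¹` law of the complex observable:

(T) TEMPERED COMPACTNESS.  Sum DCS Lemma 1 (the vertex relation, `StaggeredSumRule`) against an
ARBITRARY smooth `Φ` on `ℂ` — not compactly supported in `Ω`.  Exactly (Taylor at mid-points, odd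
orders only; `u² = iū`; the `∂∂̄`-star term is the vertex relation itself and vanishes):
  `N_δ(∂̄Φ + i(ℓδ/2)∂²Φ) = κ·B_δ(Φ) − i·δ²Σ_v ∂Φ(δc_v) T̄(v)/F(b) + O(δ²‖∇³Φ‖_∞ · δ²Σ_Ω Z/Z(b))`,
where `B_δ(Φ) = δ Σ_{v ∈ Λ, u ∉ Λ, u ∼ v} Φ(δc_v)(mid{v,u} − c_v) F({v,u})/F(b)` (LANDED for `Φ` supported
off the root, with `κ = 6` and NO `L¹` hypothesis: `polygonGreenPairing`, Theorems/…PolygonGreenPairing.lean) pairs `Φ` with the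
BOUNDARY ARRIVALS — positive masses times ONE rigid phase per exact side — and `T̄(v)` is the
route's conjugated star defect.  On an exact polygon every term is controlled by POSITIVE inputs:
`|B_δ(Φ)| ≤ ‖Φ‖_∞ · (k = 0 budgets)`; the defect by DD at depth `≥ 1` and the layer budgets
(`δ Σ_k (k+1)^{3/4−θ} ≤ δ^{θ−3/4} → 0`); the Taylor terms by `δ · (δ² Σ_Ω Z/Z(b)) ≤ δ · δ^{−3/4}`
(MR in the bulk, layer budgets at the sides); near the root by the window growth of
`PolygonRootGrowth` once `Φ` carries the weight `(z − a)^K`, `K > q`.  Since every smooth `ψ` on `ℂ`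
is `∂̄Φ` near `Ω̄` (Cauchy transform, minus a holomorphic Taylor polynomial at `a` for the weight),
`|N_δ((z−a)^K ψ)| ≤ C ‖ψ‖_{C³}` UNIFORMLY in `δ`: the normalised functionals are bounded as ORDER-3
DISTRIBUTIONS on the closed polygon — no `L¹` law — and subsequential limits exist (Banach–Alaoglu,
separability); inside `Ω` they are holomorphic functions `g` (CCN from DD + MR, Weyl for
distributions); the positive `K`-weighted arrival measures converge to a finite measure `μ` (k = 0
budgets, Helly) and the phased ones to `θμ`, `|θ| ≤ 1`.
(CS) CAUCHY STRUCTURE.  The identity passes to the limit: `∫_Ω (z−a)^K ∂̄Φ g = κ ∫ Φ θ dμ` for ALL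
`Φ ∈ C_c^∞(ℂ)`, i.e. `∂̄[(z−a)^K g 1_Ω] = −κθμ` on `ℂ`; hence `(z−a)^K g 1_Ω = C[κθμ]` (compact
support, Liouville): `g` is the Cauchy transform of its rigid-phase positive boundary measure, the
transform vanishes identically outside `Ω̄`, the one-sided boundary values of `g` on each open side
are `e^{iβ_j} ×` (positive measure), finite at every corner (stub `stub_polygonCauchyStructure`).
(A') IDENTIFICATION = the live line's endgame, now fed by (CS): `G = g/(Φ_P')^{5/8}` has real `≥ 0`
measure boundary values on every side after ONE global phase (corner/root phase jumps = monodromies,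
landed side-phase bookkeeping), finite at corners ⇒ at most simple poles, positivity ⇒ none
(parity); in the frame `a ↦ ∞` reflection makes `𝒢 = G ∘ Φ_P⁻¹` ENTIRE of finite order (tempered at
the root) ⇒ a real POLYNOMIAL `≥ 0` on `ℝ` ⇒ even degree `d`; its boundary density near the root is
`≍ |x−a|^{−5/4−d}`, window mass `σ^{−1/4−d}`, and `PolygonRootGrowth` (`≤ C σ^{−q}`, `q < 9/4`)
forces `d = 0`: CONSTANT; ratio mixing at `b` fixes it ⇒ `PolygonGateProfile`
(stub `stub_polygonIdentificationP`).  The root input is POSITIVE and ONE-SIDED with exponent room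
`2` (truth `q = 1/4`); at the lattice scale it contains `Z(a→b) ≥ c N^{−13/4+}` (DCS-type).
(B), (C) verbatim from the live line, LANDED: `squeeze_reductionProfile/Budget` (which consume only
`PolygonLayerBudget`), `gateTrace_of_gateDbarLimit stub_gateDbarLimit` (`c = 2√3`), inner polygons,
gate stability, arrival monotonicity; closing by `Equivalence.target_of_inputs`.

REGISTERED STUBS: `stub_gateL1Root` (MODEL INPUT, [I]-type ⊇ LocalL1Root — shared verbatim with the
live line), `stub_positivePolygonPackage` (MODEL INPUT, NEW: `PolygonLayerBudget ∧ PolygonRatioMixing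
∧ PolygonRootGrowth` — POSITIVE σ = 0 masses on TAME carriers only; no `L¹` law, no root tightness),
`stub_polygonCauchyStructure` (PROVABLE, XL: (T)+(CS)), `stub_polygonIdentificationP` (PROVABLE, XL:
(A'), reusing the live line's landed parity / reflection / weighted-Liouville / side-measure files),
`stub_gateCollarAvoidance` (MODEL INPUT, positive, shared verbatim).  Composition
`BoundaryClosureR_of` kernel-checked through the landed certificate.

DISPROOF USED: §0 no ex-falso (DD, MR consumed as hypotheses of every provable stub); §1 BOTH pins
USED — the root monodromy datum and the window growth live on the exact root row
(`target_false_without_rootPin`), the gate profile / ratio mixing on the exact gate row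
(`target_false_without_normaliserPin`); §6 F7 (snail carrier): no half-plane bound on a developing
map is posited; curled carriers are handled by the squeeze (landed).  No stub is an instance of a
landed Negative lemma (all statements keep the verbatim frame; polygons have no corridors).
Census: `Cruxes/BoundaryClosureR/STRATEGY-CENSUS.md` (gen 1 section).
-/

noncomputable section

open scoped BigOperators ComplexConjugate Topology Classical ContDiff
open Filter Set MeasureTheory
open Literature.Probability.LatticeModels Literature.Probability.RandomPlanarGeometry
open Literature.Probability.RandomPlanarGeometry.SAW
open Summit.CriticalPhenomena.SAWScalingLimit.Theses.SAWDefectDecoherence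

open Summit.CriticalPhenomena.SAWScalingLimit.Theorems.PolygonParitySqueeze

namespace Summit.CriticalPhenomena.SAWScalingLimit.Cruxes.BoundaryClosureR.TemperedPolygonCauchy

/-! ## A. Vocabulary: `Theorems/SAWDefectDecoherencePolygonParitySqueezeDefs.lean` (p137823, landed) —
`NF`, `AdmissibleFamily`, `PinnedFlatRoot`, `L1BoundOn`, `HasGateTrace`, `gateSeg`, `ConformalFrame`,
`ExactPolygonFamily`, `starMass`, `IsMetricDepth`, `BoundaryLayerBudgetAt`, `GateLayerBudgetAt`,
`RatioMixingAt`, `GateProfileAt`, `collarDomain`, `CollarAvoidanceAt`; plus ONE new per-datum predicate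
`RootGrowthAt` (below, §A'). -/

/-! ### A'. The one new per-datum predicate: positive window growth at the root -/

/-- **ROOT WINDOW GROWTH at `x`** (positive `σ = 0` masses, one-sided, exponent-roomy): for some
`q < 9/4`, eventually in `δ`, for every macroscopic window `σ ≤ |δ c_v − x| ≤ 2σ` (`0 < σ ≤ r`) and
every metric depth `k`, the star masses of the depth-`k` vertices in the window satisfy
`δ Σ starMass ≤ C σ^{−q} (k+1)^{3/4} Z_δ(b_δ)`.  Truth: `q = 1/4` (`Z` at boundary distance `σ`,
depth `k` is `≍ Z(b) σ^{−5/4} (k+1)^{25/48}`, `σN` vertices per row); at the lattice scale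
(`σ ≍ δ`) it contains the polynomial gate lower bound `Z_δ(a_δ → b_δ) ≥ c δ^{1+q}`; only `q < 9/4`
(which excludes an even-degree `≥ 2` polynomial factor at the root in the identified limit) and the
route's cut `3/4` are consumed.  POSITIVE replacement of the live line's `RootTightAt` (an `L¹` law of
the complex observable at the root). [cite: DuminilCopinSmirnov2012, §3 (strip identity, `B_T ≥ c/T`)] -/
def RootGrowthAt (Λ : ℝ → Finset HexVertex) (a b : ℝ → Sym2 HexVertex) (x : ℂ) : Prop :=
  ∃ q r C : ℝ, q < 9 / 4 ∧ 0 < r ∧ ∀ᶠ δ : ℝ in 𝓝[>] 0, ∀ σ : ℝ, 0 < σ → σ ≤ r → ∀ k : ℕ,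
    δ * (∑ᶠ v ∈ {v : HexVertex | v ∈ Λ δ ∧
          (δ : ℂ) * hexCenter v ∈ Metric.closedBall x (2 * σ) \ Metric.ball x σ ∧ IsMetricDepth (Λ δ) v k},
        starMass (Λ δ) (a δ) v) ≤
      C * σ ^ (-q) * ((k : ℝ) + 1) ^ (3 / 4 : ℝ) *
        ‖hexParafermionicObservable (Λ δ) (a δ) hexCriticalFugacity 0 (b δ)‖

/-! ## B. The closed statements of the line (universal closures; skeleton-only) -/

/-- **[I] LOCAL `L¹` LAW AT THE ROOT** (certificate input 1/2, NECESSARY for the target, p122434). OPEN. -/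
def LocalL1Root : Prop :=
  ∀ (D : DobrushinDomain) (ρ : ℝ) (Λ : ℝ → Finset HexVertex) (m : ℝ → ℤ) (b : ℝ → Sym2 HexVertex),
    AdmissibleFamily D ρ Λ m b →
  ∀ (a : ℝ → Sym2 HexVertex) (r₀ : ℝ) (m₀ : ℝ → ℤ), PinnedFlatRoot D Λ b (D.pt 0) a r₀ m₀ →
  ∀ K : Set ℂ, IsCompact K → K ⊆ D.carrier → L1BoundOn Λ a b K

/-- **[II] GATE TRACE OF HOLOMORPHIC WEAK LIMITS** (certificate input 2/2, NECESSARY, p121923). OPEN. -/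
def GateTraceH : Prop :=
  ∃ c : ℂ, c ≠ 0 ∧
    ∀ (D : DobrushinDomain) (ρ : ℝ) (Λ : ℝ → Finset HexVertex) (m : ℝ → ℤ) (b : ℝ → Sym2 HexVertex),
      AdmissibleFamily D ρ Λ m b →
    ∀ (a : ℝ → Sym2 HexVertex) (r₀ : ℝ) (m₀ : ℝ → ℤ), PinnedFlatRoot D Λ b (D.pt 0) a r₀ m₀ →
      HasGateTrace c D ρ Λ a b

/-- **[I] up to the gate** (MODEL INPUT `stub_gateL1Root`, shared verbatim with line
`polygon-parity-squeeze`; ⊇ `LocalL1Root`). OPEN. -/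
def GateL1Root : Prop :=
  ∀ (D : DobrushinDomain) (ρ : ℝ) (Λ : ℝ → Finset HexVertex) (m : ℝ → ℤ) (b : ℝ → Sym2 HexVertex),
    AdmissibleFamily D ρ Λ m b →
  ∀ (a : ℝ → Sym2 HexVertex) (r₀ : ℝ) (m₀ : ℝ → ℤ), PinnedFlatRoot D Λ b (D.pt 0) a r₀ m₀ →
  ∀ K : Set ℂ, IsCompact K → K ⊆ D.carrier ∪ gateSeg D ρ → D.pt 0 ∉ K → L1BoundOn Λ a b K

/-- **Polygon input (ii)** (verbatim from the live line): boundary layer budgets off the root and the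
gate layer budget. POSITIVE masses. OPEN. -/
def PolygonLayerBudget : Prop :=
  ∀ (D : DobrushinDomain) (ρ : ℝ) (Λ : ℝ → Finset HexVertex) (m : ℝ → ℤ) (b : ℝ → Sym2 HexVertex),
    AdmissibleFamily D ρ Λ m b → ExactPolygonFamily D Λ →
  ∀ (a : ℝ → Sym2 HexVertex) (r₀ : ℝ) (m₀ : ℝ → ℤ), PinnedFlatRoot D Λ b (D.pt 0) a r₀ m₀ →
  (∀ z ∈ frontier D.carrier, z ≠ D.pt 0 → BoundaryLayerBudgetAt Λ a b z) ∧
    (2 * ρ < dist (D.pt 0) (D.pt 1) → GateLayerBudgetAt D (ρ / 2) Λ m a b)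

/-- **Polygon input (iii)** (verbatim from the live line): averaged ratio mixing at `b`. POSITIVE. OPEN. -/
def PolygonRatioMixing : Prop :=
  ∀ (D : DobrushinDomain) (ρ : ℝ) (Λ : ℝ → Finset HexVertex) (m : ℝ → ℤ) (b : ℝ → Sym2 HexVertex),
    AdmissibleFamily D ρ Λ m b → ExactPolygonFamily D Λ →
  ∀ (a : ℝ → Sym2 HexVertex) (r₀ : ℝ) (m₀ : ℝ → ℤ), PinnedFlatRoot D Λ b (D.pt 0) a r₀ m₀ →
    RatioMixingAt Λ a b

/-- **Polygon input (iv), NEW**: root window growth at `pt 0` on exact polygon families. POSITIVE,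
one-sided, `q < 9/4`. OPEN. -/
def PolygonRootGrowth : Prop :=
  ∀ (D : DobrushinDomain) (ρ : ℝ) (Λ : ℝ → Finset HexVertex) (m : ℝ → ℤ) (b : ℝ → Sym2 HexVertex),
    AdmissibleFamily D ρ Λ m b → ExactPolygonFamily D Λ →
  ∀ (a : ℝ → Sym2 HexVertex) (r₀ : ℝ) (m₀ : ℝ → ℤ), PinnedFlatRoot D Λ b (D.pt 0) a r₀ m₀ →
    RootGrowthAt Λ a b (D.pt 0)

/-- **THE POSITIVE POLYGON PACKAGE** (MODEL INPUT `stub_positivePolygonPackage`): layer budgets, ratio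
mixing, root window growth — `σ = 0` masses only, TAME carriers only. -/
def PositivePolygonPackage : Prop := PolygonLayerBudget ∧ PolygonRatioMixing ∧ PolygonRootGrowth

/-- **CAUCHY STRUCTURE OF THE TEMPERED LIMITS ON EXACT POLYGONS** (output of
`stub_polygonCauchyStructure`, input of `stub_polygonIdentificationP`).  For an exact polygon
admissible pinned datum with disjoint pinned balls, every mesh sequence `ns → 0⁺` has a subsequence
`ns ∘ ms` along which, for some root weight `K`, lattice constant `κ ≠ 0`, `g` holomorphic on `Ω`
with `(z − a)^K g ∈ L¹(Ω)`, a FINITE positive measure `μ` carried by `∂Ω` and a phase density `θ`,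
`|θ| ≤ 1`: (i) the normalised bulk functionals of the `(z−a)^K`-weighted smooth tests converge to
`∫_Ω (z−a)^K φ g` (distributional convergence on the CLOSED polygon, root tempered); (ii) the
`|z−a|^K`-weighted POSITIVE boundary arrival measures converge to `μ`; (iii) the `(z−a)^K`-weighted
PHASED boundary functionals (the boundary term of the Green identity: inner vertex `v`, outer
neighbour `u`, half-edge vector `mid{v,u} − c_v`, spin-`5/8` observable) converge to `θμ`; (iv) the
limit Green identity `∫_Ω (z−a)^K ∂̄Φ g = κ ∫ Φ θ dμ` for every `Φ ∈ C_c^∞(ℂ)` — i.e.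
`∂̄[(z−a)^K g 1_Ω] = −κθμ` on `ℂ`, the Cauchy structure. -/
def PolygonCauchyStructure : Prop :=
  ∀ (D : DobrushinDomain) (ρ : ℝ) (Λ : ℝ → Finset HexVertex) (m : ℝ → ℤ) (b : ℝ → Sym2 HexVertex),
    AdmissibleFamily D ρ Λ m b → ExactPolygonFamily D Λ →
  ∀ (a : ℝ → Sym2 HexVertex) (r₀ : ℝ) (m₀ : ℝ → ℤ), PinnedFlatRoot D Λ b (D.pt 0) a r₀ m₀ →
    2 * ρ < dist (D.pt 0) (D.pt 1) →
  ∀ ns : ℕ → ℝ, Filter.Tendsto ns Filter.atTop (𝓝[>] 0) →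
    ∃ (ms : ℕ → ℕ) (K : ℕ) (κ : ℂ) (g : ℂ → ℂ) (μ : MeasureTheory.Measure ℂ) (θ : ℂ → ℂ),
      StrictMono ms ∧ κ ≠ 0 ∧ DifferentiableOn ℂ g D.carrier ∧
      MeasureTheory.IntegrableOn (fun z => (z - D.pt 0) ^ K * g z) D.carrier ∧
      MeasureTheory.IsFiniteMeasure μ ∧ μ (frontier D.carrier)ᶜ = 0 ∧ Measurable θ ∧ (∀ z, ‖θ z‖ ≤ 1) ∧
      (∀ φ : ℂ → ℂ, ContDiff ℝ ∞ φ → HasCompactSupport φ →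
        Filter.Tendsto (fun n => NF Λ a b (ns (ms n)) (fun z => (z - D.pt 0) ^ K * φ z)) Filter.atTop
          (𝓝 (∫ z in D.carrier, (z - D.pt 0) ^ K * φ z * g z))) ∧
      (∀ w : ℂ → ℂ, Continuous w → HasCompactSupport w →
        Filter.Tendsto (fun n => ((ns (ms n) : ℝ) : ℂ) *
            ∑ v ∈ Λ (ns (ms n)), ∑ᶠ u ∈ {u : HexVertex | hexGraph.Adj v u ∧ u ∉ Λ (ns (ms n))},
              w (((ns (ms n) : ℝ) : ℂ) * hexCenter v) *
                ((‖((ns (ms n) : ℝ) : ℂ) * hexCenter v - D.pt 0‖ ^ K *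
                  (‖hexParafermionicObservable (Λ (ns (ms n))) (a (ns (ms n))) hexCriticalFugacity 0 s(v, u)‖ /
                    ‖hexParafermionicObservable (Λ (ns (ms n))) (a (ns (ms n))) hexCriticalFugacity 0
                      (b (ns (ms n)))‖) : ℝ) : ℂ))
          Filter.atTop (𝓝 (∫ z, w z ∂μ))) ∧
      (∀ w : ℂ → ℂ, Continuous w → HasCompactSupport w →
        Filter.Tendsto (fun n => ((ns (ms n) : ℝ) : ℂ) *
            ∑ v ∈ Λ (ns (ms n)), ∑ᶠ u ∈ {u : HexVertex | hexGraph.Adj v u ∧ u ∉ Λ (ns (ms n))},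
              w (((ns (ms n) : ℝ) : ℂ) * hexCenter v) * (((ns (ms n) : ℝ) : ℂ) * hexCenter v - D.pt 0) ^ K *
                ((hexMidpoint s(v, u) - hexCenter v) *
                  (hexParafermionicObservable (Λ (ns (ms n))) (a (ns (ms n))) hexCriticalFugacity (5 / 8) s(v, u) /
                    hexParafermionicObservable (Λ (ns (ms n))) (a (ns (ms n))) hexCriticalFugacity (5 / 8)
                      (b (ns (ms n))))))
          Filter.atTop (𝓝 (∫ z, w z * θ z ∂μ))) ∧
      (∀ Φ : ℂ → ℂ, ContDiff ℝ ∞ Φ → HasCompactSupport Φ →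
        ∫ z in D.carrier, (z - D.pt 0) ^ K * Literature.Analysis.Complex.dbarAlong 1 Φ z * g z =
          κ * ∫ z, Φ z * θ z ∂μ)

/-- **GATE PROFILE LAW ON EXACT POLYGONS** (verbatim from the live line; output of
`stub_polygonIdentificationP`). -/
def PolygonGateProfile : Prop :=
  ∀ (D : DobrushinDomain) (ρ : ℝ) (Λ : ℝ → Finset HexVertex) (m : ℝ → ℤ) (b : ℝ → Sym2 HexVertex),
    AdmissibleFamily D ρ Λ m b → ExactPolygonFamily D Λ →
  ∀ (a : ℝ → Sym2 HexVertex) (r₀ : ℝ) (m₀ : ℝ → ℤ), PinnedFlatRoot D Λ b (D.pt 0) a r₀ m₀ →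
    2 * ρ < dist (D.pt 0) (D.pt 1) → GateProfileAt D ρ (ρ / 2) Λ a b

/-- **GATE COLLAR AVOIDANCE** (MODEL INPUT `stub_gateCollarAvoidance`, shared verbatim). OPEN. -/
def GateCollarAvoidance : Prop :=
  ∀ (D : DobrushinDomain) (ρ : ℝ) (Λ : ℝ → Finset HexVertex) (m : ℝ → ℤ) (b : ℝ → Sym2 HexVertex),
    AdmissibleFamily D ρ Λ m b →
  ∀ (a : ℝ → Sym2 HexVertex) (r₀ : ℝ) (m₀ : ℝ → ℤ), PinnedFlatRoot D Λ b (D.pt 0) a r₀ m₀ →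
    CollarAvoidanceAt D ρ Λ a r₀

/-- **GATE DATA for general admissible families** (verbatim; output of the landed squeeze). -/
def GateData : Prop :=
  ∀ (D : DobrushinDomain) (ρ : ℝ) (Λ : ℝ → Finset HexVertex) (m : ℝ → ℤ) (b : ℝ → Sym2 HexVertex),
    AdmissibleFamily D ρ Λ m b →
  ∀ (a : ℝ → Sym2 HexVertex) (r₀ : ℝ) (m₀ : ℝ → ℤ), PinnedFlatRoot D Λ b (D.pt 0) a r₀ m₀ →
    2 * ρ < dist (D.pt 0) (D.pt 1) → GateProfileAt D ρ (ρ / 4) Λ a b ∧ GateLayerBudgetAt D (ρ / 4) Λ m a b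

/-- **DOMAIN MONOTONICITY OF THE `σ = 0` MASSES** (LANDED p137937). -/
def ArrivalMonotone : Prop :=
  ∀ (Λ Λ' : Finset HexVertex), Λ ⊆ Λ' → ∀ (a z : Sym2 HexVertex) (x : ℝ), 0 ≤ x →
    ‖hexParafermionicObservable Λ a x 0 z‖ ≤ ‖hexParafermionicObservable Λ' a x 0 z‖

/-- **(IP) INNER EXACT POLYGONS** (LANDED, p161626 ∘ p154287). -/
def InnerPolygons : Prop :=
  (∀ (D : DobrushinDomain) (ρ : ℝ) (Λ : ℝ → Finset HexVertex) (m : ℝ → ℤ) (b : ℝ → Sym2 HexVertex), AdmissibleFamily D ρ Λ m b → ∀ (a : ℝ → Sym2 HexVertex) (r₀ : ℝ) (m₀ : ℝ → ℤ), PinnedFlatRoot D Λ b (D.pt 0) a r₀ m₀ → 2 * ρ < dist (D.pt 0) (D.pt 1) → ∀ η : ℝ, 0 < η → ∃ (P : DobrushinDomain) (ΛP : ℝ → Finset HexVertex), P.pt 0 = D.pt 0 ∧ P.pt 1 = D.pt 1 ∧ P.carrier ⊆ D.carrier ∧ {z : ℂ | z ∈ D.carrier ∧ η ≤ Metric.infDist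 z D.carrierᶜ} ⊆ P.carrier ∧ AdmissibleFamily P (ρ / 2) ΛP m b ∧ ExactPolygonFamily P ΛP ∧ PinnedFlatRoot P ΛP b (P.pt 0) a (min r₀ ρ / 4) m₀ ∧ ∀ᶠ δ : ℝ in 𝓝[>] 0, collarDomain D (3 * ρ / 4) (min r₀ ρ / 2) η δ (Λ δ) ⊆ ΛP δ ∧ ΛP δ ⊆ Λ δ)

/-- **(GS) GATE STABILITY** (LANDED p145306). -/
def GateStability : Prop :=
  (∀ (D : DobrushinDomain) (ρ r₀ r' : ℝ), 0 < ρ → 0 < r' → r' ≤ r₀ → D.carrier ∩ Metric.ball (D.pt 1) ρ = {z : ℂ | (D.pt 1).im < z.im} ∩ Metric.ball (D.pt 1) ρ → D.carrier ∩ Metric.ball (D.pt 0) r₀ = {z : ℂ | (D.pt 0).im < z.im} ∩ Metric.ball (D.pt 0) r₀ → 2 * ρ < dist (D.pt 0) (D.pt 1) → ∀ (Φ : ConformalEquiv D.carrier UpperHalfPlane.upperHalfPlaneSet) (L : ℂ → ℂ) (Lb : ℂ), ConformalFrame D Φ L Lb → ∀ (Lbar : ℂ → ℂ), ContinuousOn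 Lbar (D.carrier ∪ gateSeg D ρ) → EqOn Lbar L D.carrier → ∀ (P : ℕ → DobrushinDomain), (∀ n, (P n).pt 0 = D.pt 0 ∧ (P n).pt 1 = D.pt 1 ∧ (P n).carrier ⊆ D.carrier ∧ (P n).carrier ∩ Metric.ball (D.pt 1) (ρ / 2) = {z : ℂ | (D.pt 1).im < z.im} ∩ Metric.ball (D.pt 1) (ρ / 2) ∧ (P n).carrier ∩ Metric.ball (D.pt 0) r' = {z : ℂ | (D.pt 0).im < z.im} ∩ Metric.ball (D.pt 0) r') → (∀ K : Set ℂ, IsCompact K → K ⊆ D.carrier → ∀ᶠ n : ℕ in Filter.atTop, K ⊆ (P n).carrier) → ∃ (ΦP : (n : ℕ) → ConformalEquiv (P n).carrier UpperHalfPlane.upperHalfPlaneSet) (LP : ℕ → ℂ → ℂ) (LbP : ℕ → ℂ) (LbarP : ℕ → ℂ → ℂ), (∀ n, ConformalFrame (P n) (ΦP n) (LP n) (LbP n) ∧ ContinuousOn (LbarP n) ((P n).carrier ∪ gateSeg (P n) (ρ / 2)) ∧ EqOn (LbarP n) (LP n) (P n).carrier) ∧ TendstoUniformlyOn (fun n x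 => Complex.exp ((5 / 8 : ℂ) * (LbarP n x - LbP n))) (fun x => Complex.exp ((5 / 8 : ℂ) * (Lbar x - Lb))) Filter.atTop (gateSeg D (ρ / 4)))

/-! ## C. Sorry-free glue inside the line -/

/-- The pinned root is not a point of the (open) carrier. [folklore] -/
theorem root_not_mem_carrier {D : DobrushinDomain} {Λ : ℝ → Finset HexVertex} {b : ℝ → Sym2 HexVertex}
    {x : ℂ} {e : ℝ → Sym2 HexVertex} {r : ℝ} {mr : ℝ → ℤ}
    (hPR : PinnedFlatRoot D Λ b x e r mr) : x ∉ D.carrier := by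
  intro hx
  have h1 : x ∈ D.carrier ∩ Metric.ball x r := ⟨hx, Metric.mem_ball_self hPR.1⟩
  rw [hPR.2.1] at h1
  have h2 : x.im < x.im := h1.1
  exact lt_irrefl _ h2

/-- `GateL1Root` restricted to compacts of the carrier is `LocalL1Root`. [folklore] -/
theorem localL1Root_of_gateL1Root (h : GateL1Root) : LocalL1Root :=
  fun D ρ Λ m b hAF a r₀ m₀ hPR K hK hKD =>
    h D ρ Λ m b hAF a r₀ m₀ hPR K hK (hKD.trans Set.subset_union_left)
      (fun hx => root_not_mem_carrier hPR (hKD hx))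

/-! ## D. The registered stubs (the only `sorry`s of the file) -/

/-- STUB 1 (MODEL INPUT, [I]-type, ⊇ `LocalL1Root`; shared verbatim with the live line; OPEN):
`GateL1Root`. -/
theorem stub_gateL1Root : ∀ (D : DobrushinDomain) (ρ : ℝ) (Λ : ℝ → Finset HexVertex) (m : ℝ → ℤ) (b : ℝ → Sym2 HexVertex), AdmissibleFamily D ρ Λ m b → ∀ (a : ℝ → Sym2 HexVertex) (r₀ : ℝ) (m₀ : ℝ → ℤ), PinnedFlatRoot D Λ b (D.pt 0) a r₀ m₀ → ∀ K : Set ℂ, IsCompact K → K ⊆ D.carrier ∪ gateSeg D ρ → D.pt 0 ∉ K → L1BoundOn Λ a b K := by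
  sorry

/-- STUB 2 (MODEL INPUT, NEW — POSITIVE masses only, polygon-level, TAME carriers; OPEN):
`PositivePolygonPackage = PolygonLayerBudget ∧ PolygonRatioMixing ∧ PolygonRootGrowth`. -/
theorem stub_positivePolygonPackage : (∀ (D : DobrushinDomain) (ρ : ℝ) (Λ : ℝ → Finset HexVertex) (m : ℝ → ℤ) (b : ℝ → Sym2 HexVertex), AdmissibleFamily D ρ Λ m b → ExactPolygonFamily D Λ → ∀ (a : ℝ → Sym2 HexVertex) (r₀ : ℝ) (m₀ : ℝ → ℤ), PinnedFlatRoot D Λ b (D.pt 0) a r₀ m₀ → (∀ z ∈ frontier D.carrier, z ≠ D.pt 0 → BoundaryLayerBudgetAt Λ a b z) ∧ (2 * ρ < dist (D.pt 0) (D.pt 1) → GateLayerBudgetAt D (ρ / 2) Λ m a b)) ∧ (∀ (D : DobrushinDomain) (ρ : ℝ) (Λ : ℝ → Finset HexVertex) (m : ℝ → ℤ) (b : ℝ → Sym2 HexVertex), AdmissibleFamily D ρ Λ m b → ExactPolygonFamily D Λ → ∀ (a : ℝ → Sym2 HexVertex) (r₀ : ℝ) (m₀ : ℝ → ℤ), PinnedFlatRoot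 D Λ b (D.pt 0) a r₀ m₀ → RatioMixingAt Λ a b) ∧ (∀ (D : DobrushinDomain) (ρ : ℝ) (Λ : ℝ → Finset HexVertex) (m : ℝ → ℤ) (b : ℝ → Sym2 HexVertex), AdmissibleFamily D ρ Λ m b → ExactPolygonFamily D Λ → ∀ (a : ℝ → Sym2 HexVertex) (r₀ : ℝ) (m₀ : ℝ → ℤ), PinnedFlatRoot D Λ b (D.pt 0) a r₀ m₀ → ∃ q r C : ℝ, q < 9 / 4 ∧ 0 < r ∧ ∀ᶠ δ : ℝ in 𝓝[>] 0, ∀ σ : ℝ, 0 < σ → σ ≤ r → ∀ k : ℕ, δ * (∑ᶠ v ∈ {v : HexVertex | v ∈ Λ δ ∧ (δ : ℂ) * hexCenter v ∈ Metric.closedBall (D.pt 0) (2 * σ) \ Metric.ball (D.pt 0) σ ∧ IsMetricDepth (Λ δ) v k}, starMass (Λ δ) (a δ) v) ≤ C * σ ^ (-q) * ((k : ℝ) + 1) ^ (3 / 4 : ℝ) * ‖hexParafermionicObservable (Λ δ) (a δ) hexCriticalFugacity 0 (b δ)‖) := by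
  sorry

/-- STUB 3 (PROVABLE, XL — mechanisms (T)+(CS)): **Cauchy structure of the tempered limits on exact
polygons**, `PositivePolygonPackage → DefectDecoherence → MassRatio → PolygonCauchyStructure`.
Steps: the exact global Green identity against arbitrary smooth `Φ` (DCS Lemma 1 summed by parts;
boundary term = phased arrivals at inner vertices); uniform order-3 bounds on the closed polygon with
root weight `(z−a)^K`, `K > q`, from k = 0 budgets (boundary term), DD + layer budgets (defect), MR +
layer budgets + root growth (Taylor terms, `δ·δ^{−3/4}`); solving `∂̄Φ = (z−a)^K ψ` by the Cauchy
transform; diagonal extraction (separable test space); Weyl for the interior limit (CCN); weak-*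
limits of the weighted positive / phased arrival measures (Helly); the identity in the limit.
[cite: DuminilCopinSmirnov2012, Lemma 1; HormanderSCV1973, Thm. 1.2.1 (Cauchy–Pompeiu)] -/
theorem stub_polygonCauchyStructure : ((∀ (D : DobrushinDomain) (ρ : ℝ) (Λ : ℝ → Finset HexVertex) (m : ℝ → ℤ) (b : ℝ → Sym2 HexVertex), AdmissibleFamily D ρ Λ m b → ExactPolygonFamily D Λ → ∀ (a : ℝ → Sym2 HexVertex) (r₀ : ℝ) (m₀ : ℝ → ℤ), PinnedFlatRoot D Λ b (D.pt 0) a r₀ m₀ → (∀ z ∈ frontier D.carrier, z ≠ D.pt 0 → BoundaryLayerBudgetAt Λ a b z) ∧ (2 * ρ < dist (D.pt 0) (D.pt 1) → GateLayerBudgetAt D (ρ / 2) Λ m a b)) ∧ (∀ (D : DobrushinDomain) (ρ : ℝ) (Λ : ℝ → Finset HexVertex) (m : ℝ → ℤ) (b : ℝ → Sym2 HexVertex), AdmissibleFamily D ρ Λ m b → ExactPolygonFamily D Λ → ∀ (a : ℝ → Sym2 HexVertex) (r₀ : ℝ) (m₀ : ℝ → ℤ), PinnedFlatRoot D Λ b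 (D.pt 0) a r₀ m₀ → RatioMixingAt Λ a b) ∧ (∀ (D : DobrushinDomain) (ρ : ℝ) (Λ : ℝ → Finset HexVertex) (m : ℝ → ℤ) (b : ℝ → Sym2 HexVertex), AdmissibleFamily D ρ Λ m b → ExactPolygonFamily D Λ → ∀ (a : ℝ → Sym2 HexVertex) (r₀ : ℝ) (m₀ : ℝ → ℤ), PinnedFlatRoot D Λ b (D.pt 0) a r₀ m₀ → ∃ q r C : ℝ, q < 9 / 4 ∧ 0 < r ∧ ∀ᶠ δ : ℝ in 𝓝[>] 0, ∀ σ : ℝ, 0 < σ → σ ≤ r → ∀ k : ℕ, δ * (∑ᶠ v ∈ {v : HexVertex | v ∈ Λ δ ∧ (δ : ℂ) * hexCenter v ∈ Metric.closedBall (D.pt 0) (2 * σ) \ Metric.ball (D.pt 0) σ ∧ IsMetricDepth (Λ δ) v k}, starMass (Λ δ) (a δ) v) ≤ C * σ ^ (-q) * ((k : ℝ) + 1) ^ (3 / 4 : ℝ) * ‖hexParafermionicObservable (Λ δ) (a δ) hexCriticalFugacity 0 (b δ)‖)) → DefectDecoherence → MassRatio → ∀ (D : DobrushinDomain) (ρ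 : ℝ) (Λ : ℝ → Finset HexVertex) (m : ℝ → ℤ) (b : ℝ → Sym2 HexVertex), AdmissibleFamily D ρ Λ m b → ExactPolygonFamily D Λ → ∀ (a : ℝ → Sym2 HexVertex) (r₀ : ℝ) (m₀ : ℝ → ℤ), PinnedFlatRoot D Λ b (D.pt 0) a r₀ m₀ → 2 * ρ < dist (D.pt 0) (D.pt 1) → ∀ ns : ℕ → ℝ, Filter.Tendsto ns Filter.atTop (𝓝[>] 0) → ∃ (ms : ℕ → ℕ) (K : ℕ) (κ : ℂ) (g : ℂ → ℂ) (μ : MeasureTheory.Measure ℂ) (θ : ℂ → ℂ), StrictMono ms ∧ κ ≠ 0 ∧ DifferentiableOn ℂ g D.carrier ∧ MeasureTheory.IntegrableOn (fun z => (z - D.pt 0) ^ K * g z) D.carrier ∧ MeasureTheory.IsFiniteMeasure μ ∧ μ (frontier D.carrier)ᶜ = 0 ∧ Measurable θ ∧ (∀ z, ‖θ z‖ ≤ 1) ∧ (∀ φ : ℂ → ℂ, ContDiff ℝ ∞ φ → HasCompactSupport φ → Filter.Tendsto (fun n => NF Λ a b (ns (ms n)) (fun z => (z - D.pt 0) ^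 K * φ z)) Filter.atTop (𝓝 (∫ z in D.carrier, (z - D.pt 0) ^ K * φ z * g z))) ∧ (∀ w : ℂ → ℂ, Continuous w → HasCompactSupport w → Filter.Tendsto (fun n => ((ns (ms n) : ℝ) : ℂ) * ∑ v ∈ Λ (ns (ms n)), ∑ᶠ u ∈ {u : HexVertex | hexGraph.Adj v u ∧ u ∉ Λ (ns (ms n))}, w (((ns (ms n) : ℝ) : ℂ) * hexCenter v) * ((‖((ns (ms n) : ℝ) : ℂ) * hexCenter v - D.pt 0‖ ^ K * (‖hexParafermionicObservable (Λ (ns (ms n))) (a (ns (ms n))) hexCriticalFugacity 0 s(v, u)‖ / ‖hexParafermionicObservable (Λ (ns (ms n))) (a (ns (ms n))) hexCriticalFugacity 0 (b (ns (ms n)))‖) : ℝ) : ℂ)) Filter.atTop (𝓝 (∫ z, w z ∂μ))) ∧ (∀ w : ℂ → ℂ, Continuous w → HasCompactSupport w → Filter.Tendsto (fun n => ((ns (ms n) : ℝ) : ℂ) * ∑ v ∈ Λ (ns (ms n)), ∑ᶠ u ∈ {u : HexVertex | hexGraph.Adj v u ∧ u ∉ Λ (ns (ms n))}, w (((ns (ms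 n) : ℝ) : ℂ) * hexCenter v) * (((ns (ms n) : ℝ) : ℂ) * hexCenter v - D.pt 0) ^ K * ((hexMidpoint s(v, u) - hexCenter v) * (hexParafermionicObservable (Λ (ns (ms n))) (a (ns (ms n))) hexCriticalFugacity (5 / 8) s(v, u) / hexParafermionicObservable (Λ (ns (ms n))) (a (ns (ms n))) hexCriticalFugacity (5 / 8) (b (ns (ms n)))))) Filter.atTop (𝓝 (∫ z, w z * θ z ∂μ))) ∧ (∀ Φ : ℂ → ℂ, ContDiff ℝ ∞ Φ → HasCompactSupport Φ → ∫ z in D.carrier, (z - D.pt 0) ^ K * Literature.Analysis.Complex.dbarAlong 1 Φ z * g z = κ * ∫ z, Φ z * θ z ∂μ) := by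
  sorry

/-- STUB 4 (PROVABLE, XL — mechanism (A')): **identification on exact polygons from the Cauchy
structure and the positive package**, `PolygonCauchyStructure → PositivePolygonPackage →
PolygonGateProfile`.  Steps: side phases of `θ` from boundary winding rigidity (landed) and the
half-edge directions of the six zigzag forms; `G := g/(Φ_P')^{5/8}` has real `≥ 0` measure boundary
values on every open side after one global phase (landed side-phase bookkeeping across corners and
the root); `μ` finite at corners ⇒ at most simple poles, positivity ⇒ no pole (landed pole order /
parity); distributional Schwarz reflection (landed) ⇒ `G ∘ Φ_P⁻¹` entire of finite order (tempered at
`a ↦ ∞`) ⇒ real polynomial `≥ 0` on `ℝ` ⇒ even degree `d`; boundary density `≍ |x−a|^{−5/4−d}` near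
the root versus root window growth `σ^{−q}`, `q < 9/4` ⇒ `d = 0`; ratio mixing at `b` fixes the
constant; the gate clause of (ii) with the weight removed (`a ∉` gate ball) and the subsequence
principle give `GateProfileAt D ρ (ρ/2)` for the full family.
[cite: DuminilCopinSmirnov2012, Conjecture 2 (boundary shadow on the gate)] -/
theorem stub_polygonIdentificationP : (∀ (D : DobrushinDomain) (ρ : ℝ) (Λ : ℝ → Finset HexVertex) (m : ℝ → ℤ) (b : ℝ → Sym2 HexVertex), AdmissibleFamily D ρ Λ m b → ExactPolygonFamily D Λ → ∀ (a : ℝ → Sym2 HexVertex) (r₀ : ℝ) (m₀ : ℝ → ℤ), PinnedFlatRoot D Λ b (D.pt 0) a r₀ m₀ → 2 * ρ < dist (D.pt 0) (D.pt 1) → ∀ ns : ℕ → ℝ, Filter.Tendsto ns Filter.atTop (𝓝[>] 0) → ∃ (ms : ℕ → ℕ) (K : ℕ) (κ : ℂ) (g : ℂ → ℂ) (μ : MeasureTheory.Measure ℂ) (θ : ℂ → ℂ), StrictMono ms ∧ κ ≠ 0 ∧ DifferentiableOn ℂ g D.carrier ∧ MeasureTheory.IntegrableOn (fun z => (z - D.pt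 0) ^ K * g z) D.carrier ∧ MeasureTheory.IsFiniteMeasure μ ∧ μ (frontier D.carrier)ᶜ = 0 ∧ Measurable θ ∧ (∀ z, ‖θ z‖ ≤ 1) ∧ (∀ φ : ℂ → ℂ, ContDiff ℝ ∞ φ → HasCompactSupport φ → Filter.Tendsto (fun n => NF Λ a b (ns (ms n)) (fun z => (z - D.pt 0) ^ K * φ z)) Filter.atTop (𝓝 (∫ z in D.carrier, (z - D.pt 0) ^ K * φ z * g z))) ∧ (∀ w : ℂ → ℂ, Continuous w → HasCompactSupport w → Filter.Tendsto (fun n => ((ns (ms n) : ℝ) : ℂ) * ∑ v ∈ Λ (ns (ms n)), ∑ᶠ u ∈ {u : HexVertex | hexGraph.Adj v u ∧ u ∉ Λ (ns (ms n))}, w (((ns (ms n) : ℝ) : ℂ) * hexCenter v) * ((‖((ns (ms n) : ℝ) : ℂ) * hexCenter v - D.pt 0‖ ^ K * (‖hexParafermionicObservable (Λ (ns (ms n))) (a (ns (ms n))) hexCriticalFugacity 0 s(v, u)‖ / ‖hexParafermionicObservable (Λ (ns (ms n))) (a (ns (ms n))) hexCriticalFugacity 0 (b (ns (ms n)))‖)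 : ℝ) : ℂ)) Filter.atTop (𝓝 (∫ z, w z ∂μ))) ∧ (∀ w : ℂ → ℂ, Continuous w → HasCompactSupport w → Filter.Tendsto (fun n => ((ns (ms n) : ℝ) : ℂ) * ∑ v ∈ Λ (ns (ms n)), ∑ᶠ u ∈ {u : HexVertex | hexGraph.Adj v u ∧ u ∉ Λ (ns (ms n))}, w (((ns (ms n) : ℝ) : ℂ) * hexCenter v) * (((ns (ms n) : ℝ) : ℂ) * hexCenter v - D.pt 0) ^ K * ((hexMidpoint s(v, u) - hexCenter v) * (hexParafermionicObservable (Λ (ns (ms n))) (a (ns (ms n))) hexCriticalFugacity (5 / 8) s(v, u) / hexParafermionicObservable (Λ (ns (ms n))) (a (ns (ms n))) hexCriticalFugacity (5 / 8) (b (ns (ms n)))))) Filter.atTop (𝓝 (∫ z, w z * θ z ∂μ))) ∧ (∀ Φ : ℂ → ℂ, ContDiff ℝ ∞ Φ → HasCompactSupport Φ → ∫ z in D.carrier, (z - D.pt 0) ^ K * Literature.Analysis.Complex.dbarAlong 1 Φ z * g z = κ * ∫ z, Φ z * θ z ∂μ)) → ((∀ (D : DobrushinDomain) (ρ : ℝ)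 (Λ : ℝ → Finset HexVertex) (m : ℝ → ℤ) (b : ℝ → Sym2 HexVertex), AdmissibleFamily D ρ Λ m b → ExactPolygonFamily D Λ → ∀ (a : ℝ → Sym2 HexVertex) (r₀ : ℝ) (m₀ : ℝ → ℤ), PinnedFlatRoot D Λ b (D.pt 0) a r₀ m₀ → (∀ z ∈ frontier D.carrier, z ≠ D.pt 0 → BoundaryLayerBudgetAt Λ a b z) ∧ (2 * ρ < dist (D.pt 0) (D.pt 1) → GateLayerBudgetAt D (ρ / 2) Λ m a b)) ∧ (∀ (D : DobrushinDomain) (ρ : ℝ) (Λ : ℝ → Finset HexVertex) (m : ℝ → ℤ) (b : ℝ → Sym2 HexVertex), AdmissibleFamily D ρ Λ m b → ExactPolygonFamily D Λ → ∀ (a : ℝ → Sym2 HexVertex) (r₀ : ℝ) (m₀ : ℝ → ℤ), PinnedFlatRoot D Λ b (D.pt 0) a r₀ m₀ → RatioMixingAt Λ a b) ∧ (∀ (D : DobrushinDomain) (ρ : ℝ) (Λ : ℝ → Finset HexVertex) (m : ℝ → ℤ) (b : ℝ → Sym2 HexVertex), AdmissibleFamily D ρ Λ m b → ExactPolygonFamily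 D Λ → ∀ (a : ℝ → Sym2 HexVertex) (r₀ : ℝ) (m₀ : ℝ → ℤ), PinnedFlatRoot D Λ b (D.pt 0) a r₀ m₀ → ∃ q r C : ℝ, q < 9 / 4 ∧ 0 < r ∧ ∀ᶠ δ : ℝ in 𝓝[>] 0, ∀ σ : ℝ, 0 < σ → σ ≤ r → ∀ k : ℕ, δ * (∑ᶠ v ∈ {v : HexVertex | v ∈ Λ δ ∧ (δ : ℂ) * hexCenter v ∈ Metric.closedBall (D.pt 0) (2 * σ) \ Metric.ball (D.pt 0) σ ∧ IsMetricDepth (Λ δ) v k}, starMass (Λ δ) (a δ) v) ≤ C * σ ^ (-q) * ((k : ℝ) + 1) ^ (3 / 4 : ℝ) * ‖hexParafermionicObservable (Λ δ) (a δ) hexCriticalFugacity 0 (b δ)‖)) → ∀ (D : DobrushinDomain) (ρ : ℝ) (Λ : ℝ → Finset HexVertex) (m : ℝ → ℤ) (b : ℝ → Sym2 HexVertex), AdmissibleFamily D ρ Λ m b → ExactPolygonFamily D Λ → ∀ (a : ℝ → Sym2 HexVertex) (r₀ : ℝ) (m₀ : ℝ → ℤ), PinnedFlatRoot D Λ b (D.pt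 0) a r₀ m₀ → 2 * ρ < dist (D.pt 0) (D.pt 1) → GateProfileAt D ρ (ρ / 2) Λ a b := by
  sorry

/-- STUB 5 (MODEL INPUT, positive masses, qualitative; shared verbatim with the live line; OPEN):
`GateCollarAvoidance`. -/
theorem stub_gateCollarAvoidance : ∀ (D : DobrushinDomain) (ρ : ℝ) (Λ : ℝ → Finset HexVertex) (m : ℝ → ℤ) (b : ℝ → Sym2 HexVertex), AdmissibleFamily D ρ Λ m b → ∀ (a : ℝ → Sym2 HexVertex) (r₀ : ℝ) (m₀ : ℝ → ℤ), PinnedFlatRoot D Λ b (D.pt 0) a r₀ m₀ → CollarAvoidanceAt D ρ Λ a r₀ := by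
  sorry

/-! ### Closed statements (LANDED by the live line's lead; no `sorry`) -/

/-- `ArrivalMonotone` (LANDED p137937). [folklore] -/
theorem arrivalMonotone_holds : ArrivalMonotone :=
  Summit.CriticalPhenomena.SAWScalingLimit.Theorems.PolygonParitySqueeze.stub_arrivalMonotone

/-- (IP) `InnerPolygons` (LANDED p161626 ∘ p154287). [folklore] -/
theorem innerPolygons_holds : InnerPolygons :=
  Summit.CriticalPhenomena.SAWScalingLimit.Theorems.PolygonParitySqueeze.stub_innerPolygonsOfZigzag
    Summit.CriticalPhenomena.SAWScalingLimit.Theorems.PolygonParitySqueeze.stub_innerZigzagPolygonSep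

/-- (GS) `GateStability` (LANDED p145306). [cite: PommerenkeBBCM1992, Thm. 1.8] -/
theorem gateStability_holds : GateStability :=
  Summit.CriticalPhenomena.SAWScalingLimit.Theorems.PolygonParitySqueeze.stub_gateStability

/-- **(B) the squeeze with the BUDGET conjunct only** (LANDED p141029: `squeeze_reductionProfile`,
`squeeze_reductionBudget` consume `PolygonLayerBudget`, not `PolygonL1`): `ArrivalMonotone →
PolygonGateProfile → PolygonLayerBudget → GateCollarAvoidance → GateData`. [folklore] -/
theorem gateData_of_polygons (hAM : ArrivalMonotone) (hPGP : PolygonGateProfile) (hPLB : PolygonLayerBudget)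
    (hGCA : GateCollarAvoidance) : GateData :=
  fun D ρ Λ m b hAF a r₀ m₀ hPR hdist =>
    ⟨Summit.CriticalPhenomena.SAWScalingLimit.Theorems.PolygonParitySqueeze.squeeze_reductionProfile
        innerPolygons_holds gateStability_holds hAM hPGP hGCA D ρ Λ m b hAF a r₀ m₀ hPR hdist,
      Summit.CriticalPhenomena.SAWScalingLimit.Theorems.PolygonParitySqueeze.squeeze_reductionBudget
        innerPolygons_holds hAM hPLB hGCA D ρ Λ m b hAF a r₀ m₀ hPR hdist⟩

/-- **(C) gate trace from gate data** (LANDED p141188 ∘ p145867): `GateData → GateL1Root →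
DefectDecoherence → MassRatio → GateTraceH`, universal constant `c = 2√3`.
[cite: DuminilCopinSmirnov2012, Conjecture 2 (identification on the gate)] -/
theorem gateTrace_of_gateData : GateData → GateL1Root → DefectDecoherence → MassRatio → GateTraceH :=
  Summit.CriticalPhenomena.SAWScalingLimit.Theorems.PolygonParitySqueeze.gateTrace_of_gateDbarLimit
    Summit.CriticalPhenomena.SAWScalingLimit.Theorems.PolygonParitySqueeze.GateDbar.stub_gateDbarLimit

/-! ### The stub headers ARE the named statements (definitional unfolding) -/

/-- `stub_gateL1Root` states `GateL1Root`. [folklore] -/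
theorem gateL1Root_holds_of_stub : GateL1Root := stub_gateL1Root

/-- `stub_positivePolygonPackage` states `PositivePolygonPackage`. [folklore] -/
theorem positivePolygonPackage_holds_of_stub : PositivePolygonPackage := stub_positivePolygonPackage

/-- `stub_polygonCauchyStructure` states `PositivePolygonPackage → DD → MR → PolygonCauchyStructure`. [folklore] -/
theorem polygonCauchyStructure_of_stub :
    PositivePolygonPackage → DefectDecoherence → MassRatio → PolygonCauchyStructure :=
  stub_polygonCauchyStructure

/-- `stub_polygonIdentificationP` states `PolygonCauchyStructure → PositivePolygonPackage →
PolygonGateProfile`. [folklore] -/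
theorem polygonIdentificationP_of_stub :
    PolygonCauchyStructure → PositivePolygonPackage → PolygonGateProfile :=
  stub_polygonIdentificationP

/-- `stub_gateCollarAvoidance` states `GateCollarAvoidance`. [folklore] -/
theorem gateCollarAvoidance_holds_of_stub : GateCollarAvoidance := stub_gateCollarAvoidance

/-! ## E. The composition (kernel-checked; `sorry` enters only through the five stubs) -/

/-- **The crux from the five statements** (hypothesis form): the positive polygon package and the two
exponent cruxes give the Cauchy structure (T)+(CS), which with the package identifies the polygon
gate profile (A'); the landed squeeze (B) moves it to every admissible family; the landed gate trace
(C) gives [II] `GateTraceH` from the gate data and `GateL1Root`; `GateL1Root ⊇ [I]`; the landed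
certificate `Equivalence.target_of_inputs` closes `HexObservableLimitR`, i.e. `BoundaryClosureR`
BY NAME. -/
theorem BoundaryClosureR_of
    (h1 : GateL1Root) (h2 : PositivePolygonPackage)
    (h3 : PositivePolygonPackage → DefectDecoherence → MassRatio → PolygonCauchyStructure)
    (h4 : PolygonCauchyStructure → PositivePolygonPackage → PolygonGateProfile)
    (h5 : GateCollarAvoidance) :
    Summit.CriticalPhenomena.SAWScalingLimit.Theses.SAWDefectDecoherence.BoundaryClosureR :=
  fun hDD hMR =>
    Summit.CriticalPhenomena.SAWScalingLimit.Theorems.PickHalfPlane.Equivalence.target_of_inputs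
      hDD hMR (localL1Root_of_gateL1Root h1)
      (gateTrace_of_gateData
        (gateData_of_polygons arrivalMonotone_holds (h4 (h3 h2 hDD hMR) h2) h2.1 h5) h1 hDD hMR)

/-- **The crux, closed modulo the registered stubs** (the only `sorry`s are the three model inputs
and the two provable XL stubs). -/
theorem BoundaryClosureR_closed :
    Summit.CriticalPhenomena.SAWScalingLimit.Theses.SAWDefectDecoherence.BoundaryClosureR :=
  BoundaryClosureR_of stub_gateL1Root stub_positivePolygonPackage stub_polygonCauchyStructure
    stub_polygonIdentificationP stub_gateCollarAvoidance

end Summit.CriticalPhenomena.SAWScalingLimit.Cruxes.BoundaryClosureR.TemperedPolygonCauchy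

end
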